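import Literature.MathematicalPhysics.QuantumLattice.HubbardHubbardModelEtaODLROProofs
import HarnessLib

/-!
# Discharge of `eta_su2_relations`: the `su(2)` algebra of Yang's `η`-pairing operators

Trunk T-QLATTICE, family `hubbard`. Sibling proof file of
`Literature/MathematicalPhysics/QuantumLattice/FermionOperators.lean`: the discharge
`eta_su2_relations_holds` of the named fact
`Literature.MathematicalPhysics.QuantumLattice.eta_su2_relations`, i.e.
`[η†_ε, η_ε] = 2 η^z` and `[η^z, η†_ε] = η†_ε` for every sign `ε : Λ → ℤˣ` on every finite `Λ`,
where `η†_ε = Σ_x ε_x c†_{x↑} c†_{x↓}` (`etaRaise ε`), `η_ε = (η†_ε)ᴴ` (`etaLower ε`) and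
`η^z = ½ (N̂ - |Λ|)` (`etaZ`). Everything is PROVED, in the concrete Jordan–Wigner matrix model of
wave 0, from two accepted sibling results: Yang's commutator at the level of Fock vectors,
`EtaPairingODLRO.etaLower_mulVec_etaRaise_mulVec` (`η (η† f) = η† (η f) + (M - N̂) f`, file
`HubbardHubbardModelEtaODLROProofs`), and `totalNumber_commutator_etaRaise_holds`
(`[N̂, η†] = 2 η†`, file `FermionOperatorsProofs`). No statement or definition is introduced or
changed.

## Source read

C. N. Yang, S. C. Zhang, *SO₄ symmetry in a Hubbard model*, Mod. Phys. Lett. B **4** (1990)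
759–766, p. 759, read in the held reprint A. Montorsi (ed.), *The Hubbard Model — a reprint
volume*, World Scientific 1992, p. 57: "It is easy to verify that
`η⁺η - ηη⁺ = Σ(a⁺a + b⁺b) - M`", and **Theorem 1**: "Defining `η⁺ = J_x + iJ_y`,
`η = J_x - iJ_y`, `J_z = ½ Σ (a⁺a + b⁺b) - ½ M` (5), one finds that `J_x`, `J_y`, `J_z` commute
with each other like the components of an angular momentum". With `J_± = J_x ± iJ_y` this is
`[η⁺, η] = [J_+, J_-] = 2 J_z` and `[J_z, η⁺] = η⁺`, which is the vendored statement
(`etaZ = J_z`, `N̂ = Σ(a⁺a + b⁺b) = totalNumber`, `M = |Λ|`). Yang–Zhang work on the periodic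
`L × L × L` lattice with `ε_r = e^{iπ·r}`; the two relations use only `ε_x² = 1` and hold
verbatim for every finite `Λ` and every `ε : Λ → ℤˣ`, as vendored (only `[H, η†] = U η†` needs
a bipartite `ε`). The same relations are printed as eq. (3) of E. Demler, S.-C. Zhang, N. Bulut,
D. J. Scalapino, *A class of collective excitations of the Hubbard model: η excitation of the
negative-U model*, Int. J. Mod. Phys. B **10** (1996) 2137 (arXiv:cond-mat/9512009, p. 3–4):
`[η₀, η†] = η†`, `[η₀, η] = -η`, `[η†, η] = 2η₀` with `η₀ = ½ (N_e - N)`.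

## Proof

First relation: by `etaLower_mulVec_etaRaise_mulVec`, for every Fock vector `f`,
`(η†η - ηη†) f = -(M - N̂) f = (N̂ - M) f = 2 η^z f`, `N̂` being diagonal with eigenvalue `#s`
on `|s⟩` (`totalNumberOp_eq_diagonal`); a matrix is determined by its action
(`Matrix.ext_iff_mulVec`). Second relation:
`η^z η† - η† η^z = ½ ((N̂ - M) η† - η† (N̂ - M)) = ½ (N̂ η† - η† N̂) = ½ · 2 η† = η†` by
`totalNumber_commutator_etaRaise_holds`.
-/

namespace Literature.MathematicalPhysics.QuantumLattice

open Matrix Finset HubbardWave0 EtaPairingODLRO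

section Hubbard

variable {Λ : Type*} [LinearOrder Λ] [Fintype Λ]

/-- `N̂` is diagonal in the occupation basis: `(N̂ f)(s) = #s · f(s)` for every Fock vector `f`.
Tasaki (2020) §9.2; Yang–Zhang (1990), eq. (10) (`N_a + N_b` on the states of Fig. 1).
[folklore] -/
theorem totalNumber_mulVec_apply (f : Fock (Orb Λ)) (s : Finset (Orb Λ)) :
    (QuantumLattice.totalNumber *ᵥ f) s = (s.card : ℂ) * f s := by
  rw [← totalNumberOp_eq_totalNumber, totalNumberOp_eq_diagonal, mulVec_diagonal]

/-- `2 η^z = N̂ - M` (`M = |Λ|`), i.e. `η^z` is Yang–Zhang's `J_z = ½ Σ(a⁺a + b⁺b) - ½ M`.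
Yang–Zhang, Mod. Phys. Lett. B 4 (1990) 759, eq. (5). [cite: YangZhang1990, eq. (5)] -/
theorem two_smul_etaZ :
    (2 : ℂ) • (etaZ : Matrix (Finset (Orb Λ)) (Finset (Orb Λ)) ℂ) =
      QuantumLattice.totalNumber -
        (Fintype.card Λ : ℂ) • (1 : Matrix (Finset (Orb Λ)) (Finset (Orb Λ)) ℂ) := by
  rw [etaZ, smul_smul]
  norm_num

/-- **First `su(2)` relation of the `η`-pairing operators**: `[η†_ε, η_ε] = 2 η^z` (`= N̂ - M`)
for every sign `ε : Λ → ℤˣ`. Yang–Zhang, Mod. Phys. Lett. B 4 (1990) 759, p. 759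
("`η⁺η - ηη⁺ = Σ(a⁺a + b⁺b) - M`") and Theorem 1, eq. (5). [cite: YangZhang1990, Theorem 1] -/
theorem etaRaise_commutator_etaLower (ε : Λ → ℤˣ) :
    etaRaise ε * etaLower ε - etaLower ε * etaRaise ε =
      (2 : ℂ) • (etaZ : Matrix (Finset (Orb Λ)) (Finset (Orb Λ)) ℂ) := by
  rw [two_smul_etaZ]
  refine Matrix.ext_iff_mulVec.2 fun f => ?_
  rw [sub_mulVec, sub_mulVec, ← mulVec_mulVec, ← mulVec_mulVec, etaLower_mulVec_etaRaise_mulVec,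
    smul_mulVec, one_mulVec]
  funext s
  simp only [Pi.sub_apply, Pi.add_apply, Pi.smul_apply, smul_eq_mul, totalNumber_mulVec_apply]
  ring

/-- **Second `su(2)` relation of the `η`-pairing operators**: `[η^z, η†_ε] = η†_ε` for every sign
`ε : Λ → ℤˣ` (`η†` creates a pair, `[N̂, η†] = 2 η†`, and the constant `½ M` drops out).
Yang–Zhang, Mod. Phys. Lett. B 4 (1990) 759, Theorem 1, eq. (5) (`J_z` and `η⁺ = J_x + iJ_y`
"commute like the components of an angular momentum"). [cite: YangZhang1990, Theorem 1] -/
theorem etaZ_commutator_etaRaise (ε : Λ → ℤˣ) :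
    etaZ * etaRaise ε - etaRaise ε * etaZ = etaRaise ε := by
  have hN : QuantumLattice.totalNumber * etaRaise ε =
      (2 : ℂ) • etaRaise ε + etaRaise ε * QuantumLattice.totalNumber :=
    eq_add_of_sub_eq (totalNumber_commutator_etaRaise_holds (Λ := Λ) ε)
  rw [etaZ, smul_mul_assoc, mul_smul_comm, ← smul_sub, sub_mul, mul_sub, smul_mul_assoc, one_mul,
    mul_smul_comm, mul_one, sub_sub_sub_cancel_right, hN, add_sub_cancel_right, smul_smul]
  norm_num

/-- **Discharge of `Literature.MathematicalPhysics.QuantumLattice.eta_su2_relations`**: for every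
sign `ε : Λ → ℤˣ` on every finite `Λ`, Yang's `η`-pairing operators satisfy the `su(2)` relations
`[η†_ε, η_ε] = 2 η^z` and `[η^z, η†_ε] = η†_ε`, `η^z = ½ (N̂ - |Λ|)`.
Yang–Zhang, Mod. Phys. Lett. B 4 (1990) 759, p. 759 and Theorem 1, eq. (5) (the pseudospin `J`,
`η⁺ = J_x + iJ_y`, `J_z = ½ Σ(a⁺a + b⁺b) - ½ M`); Demler–Zhang–Bulut–Scalapino, Int. J. Mod.
Phys. B 10 (1996) 2137, eq. (3). [cite: YangZhang1990, Theorem 1] -/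
theorem eta_su2_relations_holds : eta_su2_relations (Λ := Λ) :=
  fun ε => ⟨etaRaise_commutator_etaLower ε, etaZ_commutator_etaRaise ε⟩

end Hubbard

end Literature.MathematicalPhysics.QuantumLattice
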